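import Summits.AnomalousDissipation.AnomalousDissipation.Theorems.SolenoidalFractalHomogenisationLagrangianStepVmodDistortedAssembly
import HarnessLib

/-!
# L21 TEXTS (lead-k1l-onelevel-p1 g7, 2026-08-29) — the (ℓ3)-internal vocabulary RE-TYPED over the CLASS OF RECORD of RULING D28-8′:
# HOLONOMIC (frame) · CLAMPED · RATE-BOUNDED modulation data — DRAFT FOR THE CERTIFIER'S 3-PROBE (crux workfile; lands as amendment 3 of
# `…VmodDistortedDefs` / amendment 2 of `…CellClauseModDefs` after the probe; nothing here is registered; K1L_D open; AD NOT proved; rung F-D1.A0)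

CONVENTION (line 1, per D28-8′): the tree's distortion is DERIVATIVE-INDEX — `Torus.Visc4.conj M 𝔸 i c j e = Σ_{a,b} M c a * 𝔸 i a j b * M e b`,
`viscAdjVar 𝔹 Ψ = Σ_j (Σ_{i,c,e} ∂_e(𝔹 i c j e · (∂_c Ψ)_i)) e_j`; the class variable is `v = u ∘ X`; `distort G v = G·v` enters ONLY the constraint.

## What changes w.r.t. the landed texts (p711553 `…VmodDistortedDefs`, p712075 `…VmodDistortedAssembly`, p715838 `…Z7GlueEulerXOfVRH0`)
ONE binder: `CellClauseMod.IsModulation θ Tw nC G ↦ CellClauseMod.IsFrameModulation θ Tw nC G` (a structure EXTENDING `IsModulation` by three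
fields, all FREE for the one instance we own, the clamped exact-flow curve `τ ↦ frameG E m (jR + clamp(τ)/a) jR`):
* `clamped`   — `G t = G (max 0 (min t Tw))`: the datum only takes its window values (the distorted propagators of the frame are ALREADY built on the
                clamped curve, `FrameConj.isDistortedPropagator_conjProp_clamped`; with it `piola`/`det_one`/`near_one`/`holonomic` hold at EVERY real
                time, which the Lipschitz test class of `Torus.IsWeakTensorPassiveVectorDistortedOn` needs: tests with `Ψ 0 ≠ 0` are nonzero at small
                negative times);
* `rate`      — (R-d) pointwise RATE `|G t₂ y i j − G t₁ y i j| ≤ (θ/Tw)·|t₂ − t₁|` on `[0,Tw]` (linear onset from `G 0 = 1`; for the frame this is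
                literally the constant `C/a` with `C·T ≤ θ` inside `FrameForm.isModulation_frameG_of_closed`; kills L20-type jump onsets);
* `holonomic` — FRAME STRUCTURE `G t y * (1 + ∇φ_t(y)) = 1` for a smooth periodic displacement `φ_t` (for the frame: `φ_t = E.disp m (jR + t/a) jR`,
                `frameG = adj (frameJac)`, `frameJac = 1 + ∇disp` by `LevelRegular.flowDeriv_single_apply`, `det = 1`): the columns of `G` are
                COMMUTING coordinate fields, so (certifier gap G1) null Lagrangians and trace couplings are INVISIBLE to the distorted weak class —
                `Σ_e ∂_e (N^G)_{icje} = ½ Σ_{a,b} N_{iajb}·[Y_b, Y_a]^c = 0` (`Y_a` = column `a`; `N` antisymmetric in `a ↔ b`; Piola kills the other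
                term) and `tr(∇Ψ·G) = ∇·(GΨ) = 0` on tests / `∇·(G w) = 0` weakly on solutions — hence every member tensor may be replaced INSIDE A PROOF
                by its transverse-canonical representative (`FullBound` device below) WITHOUT any `FullBound` binder in a text (answer to D28-8′ (T-a):
                `FullBound` binders are NOT dischargeable at the head, because `SlowVectorClauseEulerPieceT` quantifies over ALL window tensors `S`, and
                `S + C·N` lies in the same transverse window).
Everything else — binder order, constants, the error functional, the data classes `IsSlow`/`IsFast`, the propagator spec `IsDistortedPropagator` — is
VERBATIM.  (A `sol`/existence field for the propagators is deliberately NOT added in this version: its discharge for the frame needs the converse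
reading lemma «Eulerian weak solution ⇒ frame reading is a distorted weak solution», not yet in the tree; memo L21 §5 files it as amendment v2.)

## Contents
§1 `CellClauseMod.IsFrameModulation` (+ `toIsModulation`, trivial bridges); §2 `VmodDist.SlowVectorClauseModECW0F`, `BlockBoundGF`, `NearMultGF` and the
weakenings `…F_of_…` from the landed texts (the F-texts have STRONGER hypotheses, hence are WEAKER statements: every landed proof transfers by
`fun h => h ∘ toIsModulation`); §3 the `FullBound` device (definition only) and the canonicalisation TOOL statement `TransverseCanonical` (a `Prop`,
to be PROVED as a Literature lemma — NOT a hypothesis of any text); §4 the assembly `modECW0F_of_blockBoundsGF_at` = p712075 verbatim over the F-texts.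
The head `Z7Glue.vmod_EX_of_VRH0F : ⟨(V)+X+W7 ⇒ ∃ θ₁ ϱ₁ Cm, ModECW0F⟩ → Vmod_E_textHTX X e` is the port of p715838 through `FrameConjugacyAtF`
(frame instance: `FrameForm.isFrameModulation_frameG_closed_pos`) — typed in the Theorems files, not here.
-/

set_option linter.dupNamespace false

noncomputable section

namespace Summit.AnomalousDissipation.AnomalousDissipation.Theorems.SolenoidalFractalHomogenisation.LagrangianStep.CellClauseMod

open Literature.Analysis Literature.Analysis.FluidPDE Literature.Analysis.FunctionSpaces
open MeasureTheory Set Filter UnitAddTorus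
open scoped ENNReal NNReal InnerProductSpace

/-! ## §1 The class of record: holonomic, clamped, rate-bounded modulation data -/

/-- **`IsFrameModulation θ Tw nC G` — the CLASS OF RECORD of the (ℓ3) line (RULING D28-8′ (T-b) ∧ (R-d)).**  A modulation datum
(`IsModulation`: `G 0 = 1`, `|G − 1| ≤ θ`, `det = 1`, Piola columns, smooth, `|∇G| ≤ θ·nC`, Lipschitz, `∫|∂_t G| ≤ θ`) which moreover
(i) is CLAMPED to its window (`G t = G (clamp t)`), (ii) has the pointwise RATE `θ/Tw` in cell time, and (iii) is HOLONOMIC: at every window time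
`G t = (1 + ∇φ_t)⁻¹` for a smooth periodic displacement `φ_t : 𝕋³ → ℝ³` (the inverse Jacobian of the map `y ↦ y + φ_t(y)`), stated as the
product identity `G t y * (1 + ∇φ_t(y)) = 1` (no matrix inverse, no junk).  The only instance ever instantiated is the clamped exact-flow frame
`τ ↦ frameG E m (jR + clamp(τ)/a(m+1)) (jR)` of a template carrier (`φ = E.disp m · (jR)`). -/
structure IsFrameModulation (θ Tw nC : ℝ) (G : ℝ → UnitAddTorus (Fin 3) → Matrix (Fin 3) (Fin 3) ℝ) : Prop
    extends IsModulation θ Tw nC G where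
  /-- the datum only takes its window values -/
  clamped : ∀ t y, G t y = G (max 0 (min t Tw)) y
  /-- (R-d) pointwise rate `θ / Tw` in cell time, uniformly in `y` -/
  rate : ∀ y i j, ∀ t₁ ∈ Icc 0 Tw, ∀ t₂ ∈ Icc 0 Tw, |G t₂ y i j - G t₁ y i j| ≤ θ / Tw * |t₂ - t₁|
  /-- holonomic (frame) structure: `G t = (1 + ∇φ_t)⁻¹`, `φ_t` smooth periodic -/
  holonomic : ∀ t ∈ Icc 0 Tw, ∃ φ : UnitAddTorus (Fin 3) → EuclideanSpace ℝ (Fin 3), Torus.IsSmooth φ ∧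
    ∀ y, G t y * Matrix.of (fun a c => (1 : Matrix (Fin 3) (Fin 3) ℝ) a c + Torus.partialDeriv c (fun z => φ z a) y) = 1

/-- The identity is a frame modulation (θ = 0). -/
theorem isFrameModulation_one {Tw nC : ℝ} : IsFrameModulation 0 Tw nC (fun _ _ => (1 : Matrix (Fin 3) (Fin 3) ℝ)) where
  toIsModulation := isModulation_one
  clamped := fun _ _ => rfl
  rate := fun y i j t₁ _ t₂ _ => by simp
  holonomic := fun t _ => ⟨fun _ => 0, Torus.isSmooth_const _, fun y => by
    have h : Matrix.of (fun a c => (1 : Matrix (Fin 3) (Fin 3) ℝ) a c + Torus.partialDeriv c (fun _ : UnitAddTorus (Fin 3) => (0 : EuclideanSpace ℝ (Fin 3)) a) y)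
        = 1 := by
      ext a c
      rw [Matrix.of_apply, show (fun _ : UnitAddTorus (Fin 3) => (0 : EuclideanSpace ℝ (Fin 3)) a) = fun _ => (0:ℝ) from rfl,
        partialDeriv_const_fun, add_zero]
    rw [h, Matrix.one_mul]⟩

/-- Outside the window a clamped datum repeats its endpoint values; in particular ALL-TIME Piola: the columns of `G t` are divergence free at
every real time. -/
theorem IsFrameModulation.piola_all {θ Tw nC : ℝ} {G : ℝ → UnitAddTorus (Fin 3) → Matrix (Fin 3) (Fin 3) ℝ} (hG : IsFrameModulation θ Tw nC G)
    (hTw : 0 ≤ Tw) (t : ℝ) (i : Fin 3) :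
    Torus.IsDivFree (fun y => (WithLp.toLp 2 fun c => G t y c i : EuclideanSpace ℝ (Fin 3))) := by
  have hmem : max 0 (min t Tw) ∈ Icc 0 Tw := ⟨le_max_left _ _, max_le hTw (min_le_right _ _)⟩
  have h := hG.piola (max 0 (min t Tw)) hmem i
  have e : (fun y => (WithLp.toLp 2 fun c => G t y c i : EuclideanSpace ℝ (Fin 3)))
      = fun y => (WithLp.toLp 2 fun c => G (max 0 (min t Tw)) y c i : EuclideanSpace ℝ (Fin 3)) := by
    funext y; simp_rw [hG.clamped t y]
  rw [e]; exact h

/-- ALL-TIME smoothness of the entries of a clamped datum. -/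
theorem IsFrameModulation.smooth_all {θ Tw nC : ℝ} {G : ℝ → UnitAddTorus (Fin 3) → Matrix (Fin 3) (Fin 3) ℝ} (hG : IsFrameModulation θ Tw nC G)
    (hTw : 0 ≤ Tw) (t : ℝ) (i j : Fin 3) : Torus.IsSmooth (fun y => G t y i j) := by
  have hmem : max 0 (min t Tw) ∈ Icc 0 Tw := ⟨le_max_left _ _, max_le hTw (min_le_right _ _)⟩
  have e : (fun y => G t y i j) = fun y => G (max 0 (min t Tw)) y i j := funext fun y => by rw [hG.clamped t y]
  rw [e]; exact hG.smooth _ hmem i j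

/-- Linear onset: `|G t − 1| ≤ (θ/Tw)·t` on the window (rate + `G 0 = 1`). -/
theorem IsFrameModulation.abs_sub_one_le_rate_mul {θ Tw nC : ℝ} {G : ℝ → UnitAddTorus (Fin 3) → Matrix (Fin 3) (Fin 3) ℝ}
    (hG : IsFrameModulation θ Tw nC G) {t : ℝ} (ht : t ∈ Icc 0 Tw) (y : UnitAddTorus (Fin 3)) (i j : Fin 3) :
    |G t y i j - (1 : Matrix (Fin 3) (Fin 3) ℝ) i j| ≤ θ / Tw * t := by
  have h := hG.rate y i j 0 ⟨le_rfl, ht.1.trans ht.2⟩ t ht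
  rw [hG.init y, sub_zero, abs_of_nonneg ht.1] at h
  exact h

end Summit.AnomalousDissipation.AnomalousDissipation.Theorems.SolenoidalFractalHomogenisation.LagrangianStep.CellClauseMod

namespace Summit.AnomalousDissipation.AnomalousDissipation.Theorems.SolenoidalFractalHomogenisation.LagrangianStep.VmodDist

open Literature.Analysis Literature.Analysis.FluidPDE Literature.Analysis.FunctionSpaces
open MeasureTheory Set
open scoped InnerProductSpace
open Summit.AnomalousDissipation.AnomalousDissipation.Theorems.SolenoidalFractalHomogenisation.LagrangianStep.CellClauseMod
open Summit.AnomalousDissipation.AnomalousDissipation.Theorems.SolenoidalFractalHomogenisation.LagrangianStep.LossCurrency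
open Summit.AnomalousDissipation.AnomalousDissipation.Theorems.SolenoidalFractalHomogenisation.LagrangianStep.VmodFlat
  (IsSlow IsFast fc fc_sub inner_eq_zero_of_fc_disjoint eta_sum_le)

/-! ## §2 The (ℓ3)-internal texts over the class of record -/

/-- **(V_modECW0F)** — `SlowVectorClauseModECW0` VERBATIM except `IsModulation ↦ IsFrameModulation` (holonomic · clamped · rate `θ/Tw`). -/
def SlowVectorClauseModECW0F {k : ℕ} (W : LatticeShear.LatticeWord k) (M : ℝ) (hM : 0 < M) (c : ℝ)
    (Φ : ℝ → Torus.Visc4 (Fin 3) → Torus.Visc4 (Fin 3)) (lo hi Λ β σ C ν₀ K θ₁ ϱ₁ : ℝ) : Prop :=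
  ∀ ν, ∀ hν : ν ∈ Set.Ioo 0 ν₀, ∀ n : ℕ, (⌈K / ν⌉₊ : ℝ) ≤ n → ∀ 𝔸 : Torus.Visc4 (Fin 3),
    Torus.OddSmall 𝔸 (ν * β) → (∃ lam ∈ Set.Icc (1:ℝ) Λ, Torus.NearIso 𝔸 (ν * (lo / lam)) (ν * (hi * lam))) →
    Torus.OddSmall (Φ ν ((1 / ν) • 𝔸)) β → (∃ lam ∈ Set.Icc (1:ℝ) Λ, Torus.NearIso (Φ ν ((1 / ν) • 𝔸)) (lo / lam) (hi * lam)) →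
    ∀ θ ∈ Set.Icc 0 θ₁, ∀ nC : ℝ, 0 ≤ nC → nC ≤ ϱ₁ * n → ∀ Tw > (0:ℝ),
    ∀ G : ℝ → UnitAddTorus (Fin 3) → Matrix (Fin 3) (Fin 3) ℝ, IsFrameModulation θ Tw nC G →
    ∀ U T : ℝ → ℝ → (V2 →L[ℝ] V2),
      IsDistortedPropagator Tw ((1 / (n:ℝ) ^ 2) • 𝔸) (cellField W M hM ν hν.1 n) G U →
      IsDistortedPropagator Tw ((1 / (n:ℝ) ^ 2) • (𝔸 + (c / ν) • Φ ν ((1 / ν) • 𝔸))) (fun _ _ => 0) G T →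
    ∀ t : ℝ, 0 < t → t ≤ Tw → ∀ x ζ : V2,
      |⟪U 0 t x - T 0 t x, ζ⟫_ℝ|
        ≤ (C * (C * (ν ^ σ + ((⌈K / ν⌉₊ : ℝ) / n) ^ σ + θ ^ σ + (nC / n) ^ σ) + (min 1 ((M * W.period / ν) / t)) ^ σ))
          * Real.sqrt (lossFwd (T 0 t) x) * Real.sqrt (lossAdj (T 0 t) ζ)

/-- **The distorted block shape over the class of record** — `BlockBoundG` VERBATIM except `IsModulation ↦ IsFrameModulation`. -/
def BlockBoundGF {k : ℕ} (W : LatticeShear.LatticeWord k) (M : ℝ) (hM : 0 < M) (c : ℝ)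
    (Φ : ℝ → Torus.Visc4 (Fin 3) → Torus.Visc4 (Fin 3)) (lo hi Λ β σ Cb ν₀ K θ₁ ϱ₁ : ℝ) (Px Pζ : ℕ → V2 → Prop) : Prop :=
  ∀ ν, ∀ hν : ν ∈ Set.Ioo 0 ν₀, ∀ n : ℕ, (⌈K / ν⌉₊ : ℝ) ≤ n → ∀ 𝔸 : Torus.Visc4 (Fin 3),
    Torus.OddSmall 𝔸 (ν * β) → (∃ lam ∈ Set.Icc (1:ℝ) Λ, Torus.NearIso 𝔸 (ν * (lo / lam)) (ν * (hi * lam))) →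
    Torus.OddSmall (Φ ν ((1 / ν) • 𝔸)) β → (∃ lam ∈ Set.Icc (1:ℝ) Λ, Torus.NearIso (Φ ν ((1 / ν) • 𝔸)) (lo / lam) (hi * lam)) →
    ∀ θ ∈ Set.Icc 0 θ₁, ∀ nC : ℝ, 0 ≤ nC → nC ≤ ϱ₁ * n → ∀ Tw > (0:ℝ),
    ∀ G : ℝ → UnitAddTorus (Fin 3) → Matrix (Fin 3) (Fin 3) ℝ, IsFrameModulation θ Tw nC G →
    ∀ U T : ℝ → ℝ → (V2 →L[ℝ] V2),
      IsDistortedPropagator Tw ((1 / (n:ℝ) ^ 2) • 𝔸) (cellField W M hM ν hν.1 n) G U →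
      IsDistortedPropagator Tw ((1 / (n:ℝ) ^ 2) • (𝔸 + (c / ν) • Φ ν ((1 / ν) • 𝔸))) (fun _ _ => 0) G T →
    ∀ t : ℝ, 0 < t → t ≤ Tw → ∀ x ζ : V2, Px n x → Pζ n ζ →
      |⟪U 0 t x - T 0 t x, ζ⟫_ℝ|
        ≤ (Cb * (Cb * (ν ^ σ + ((⌈K / ν⌉₊ : ℝ) / n) ^ σ + θ ^ σ + (nC / n) ^ σ) + (min 1 ((M * W.period / ν) / t)) ^ σ))
          * Real.sqrt (lossFwd (T 0 t) x) * Real.sqrt (lossAdj (T 0 t) ζ)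

/-- **(M_θ) over the class of record** — `NearMultG` VERBATIM except `IsModulation ↦ IsFrameModulation` (REINSTATED by D28-8′: for holonomic data the
form-level constant is `κ_gen = η/(1−η)`, `η = (hi_f Λ²/lo)·ε(2+ε)`, `ε = ‖G−1‖_op ≤ 3θ`, after transverse canonicalisation of the coarse tensor; certifier toy
`κ ≈ θ₁/2` n-uniform). -/
def NearMultGF (c : ℝ) (Φ : ℝ → Torus.Visc4 (Fin 3) → Torus.Visc4 (Fin 3)) (lo hi Λ β ν₀ K θ₁ ϱ₁ κ : ℝ) : Prop :=
  ∀ ν : ℝ, ν ∈ Set.Ioo 0 ν₀ → ∀ n : ℕ, (⌈K / ν⌉₊ : ℝ) ≤ n → ∀ 𝔸 : Torus.Visc4 (Fin 3),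
    Torus.OddSmall 𝔸 (ν * β) → (∃ lam ∈ Set.Icc (1:ℝ) Λ, Torus.NearIso 𝔸 (ν * (lo / lam)) (ν * (hi * lam))) →
    Torus.OddSmall (Φ ν ((1 / ν) • 𝔸)) β → (∃ lam ∈ Set.Icc (1:ℝ) Λ, Torus.NearIso (Φ ν ((1 / ν) • 𝔸)) (lo / lam) (hi * lam)) →
    ∀ θ ∈ Set.Icc 0 θ₁, ∀ nC : ℝ, 0 ≤ nC → nC ≤ ϱ₁ * n → ∀ Tw > (0:ℝ),
    ∀ G : ℝ → UnitAddTorus (Fin 3) → Matrix (Fin 3) (Fin 3) ℝ, IsFrameModulation θ Tw nC G →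
    ∀ T : ℝ → ℝ → (V2 →L[ℝ] V2),
      IsDistortedPropagator Tw ((1 / (n:ℝ) ^ 2) • (𝔸 + (c / ν) • Φ ν ((1 / ν) • 𝔸))) (fun _ _ => 0) G T →
    ∀ t : ℝ, 0 < t → t ≤ Tw →
      (∀ xs xf : V2, IsSlow n xs → IsFast n xf →
        |⟪T 0 t xs, T 0 t xf⟫_ℝ| ≤ κ * Real.sqrt (lossFwd (T 0 t) xs) * Real.sqrt (lossFwd (T 0 t) xf)) ∧
      (∀ ζs ζf : V2, IsSlow n ζs → IsFast n ζf →
        |⟪ContinuousLinearMap.adjoint (T 0 t) ζs, ContinuousLinearMap.adjoint (T 0 t) ζf⟫_ℝ|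
          ≤ κ * Real.sqrt (lossAdj (T 0 t) ζs) * Real.sqrt (lossAdj (T 0 t) ζf))

/-- Weakening: the landed `SlowVectorClauseModECW0` implies the F-text (the F-class is smaller). -/
theorem modECW0F_of_modECW0 {k : ℕ} {W : LatticeShear.LatticeWord k} {M : ℝ} {hM : 0 < M} {c : ℝ}
    {Φ : ℝ → Torus.Visc4 (Fin 3) → Torus.Visc4 (Fin 3)} {lo hi Λ β σ C ν₀ K θ₁ ϱ₁ : ℝ}
    (h : SlowVectorClauseModECW0 W M hM c Φ lo hi Λ β σ C ν₀ K θ₁ ϱ₁) : SlowVectorClauseModECW0F W M hM c Φ lo hi Λ β σ C ν₀ K θ₁ ϱ₁ :=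
  fun ν hν n hn 𝔸 hodd hwin hΦo hΦw θ hθ nC hnC0 hnC Tw hTw G hG U T hU hT =>
    h ν hν n hn 𝔸 hodd hwin hΦo hΦw θ hθ nC hnC0 hnC Tw hTw G hG.toIsModulation U T hU hT

/-- Weakening for the blocks. -/
theorem blockBoundGF_of_blockBoundG {k : ℕ} {W : LatticeShear.LatticeWord k} {M : ℝ} {hM : 0 < M} {c : ℝ}
    {Φ : ℝ → Torus.Visc4 (Fin 3) → Torus.Visc4 (Fin 3)} {lo hi Λ β σ Cb ν₀ K θ₁ ϱ₁ : ℝ} {Px Pζ : ℕ → V2 → Prop}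
    (h : BlockBoundG W M hM c Φ lo hi Λ β σ Cb ν₀ K θ₁ ϱ₁ Px Pζ) : BlockBoundGF W M hM c Φ lo hi Λ β σ Cb ν₀ K θ₁ ϱ₁ Px Pζ :=
  fun ν hν n hn 𝔸 hodd hwin hΦo hΦw θ hθ nC hnC0 hnC Tw hTw G hG U T hU hT =>
    h ν hν n hn 𝔸 hodd hwin hΦo hΦw θ hθ nC hnC0 hnC Tw hTw G hG.toIsModulation U T hU hT

/-- Weakening for (M_θ). -/
theorem nearMultGF_of_nearMultG {c : ℝ} {Φ : ℝ → Torus.Visc4 (Fin 3) → Torus.Visc4 (Fin 3)} {lo hi Λ β ν₀ K θ₁ ϱ₁ κ : ℝ}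
    (h : NearMultG c Φ lo hi Λ β ν₀ K θ₁ ϱ₁ κ) : NearMultGF c Φ lo hi Λ β ν₀ K θ₁ ϱ₁ κ :=
  fun ν hν n hn 𝔸 hodd hwin hΦo hΦw θ hθ nC hnC0 hnC Tw hTw G hG T hT =>
    h ν hν n hn 𝔸 hodd hwin hΦo hΦw θ hθ nC hnC0 hnC Tw hTw G hG.toIsModulation T hT

/-! ## §3 The `FullBound` DEVICE and the transverse canonicalisation TOOL (statements; proofs = Literature lemmas to come) -/

/-- **`FullBound 𝔹 h`** (certifier G1, device only — NEVER a binder of a text): the FULL bilinear form of the fourth-order tensor on arbitrary `3×3`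
velocity-gradient matrices (`Torus.gradForm`'s polarisation) is bounded by `h` in the Frobenius norms `‖ξ‖_F² = gradForm (isoVisc 1) ξ`:
`|Σ 𝔹 i a j b ξ i a η j b| ≤ h·‖ξ‖_F·‖η‖_F`. -/
def FullBound (𝔹 : Torus.Visc4 (Fin 3)) (h : ℝ) : Prop :=
  ∀ ξ η : Fin 3 → Fin 3 → ℝ,
    |∑ i, ∑ a, ∑ j, ∑ b, 𝔹 i a j b * ξ i a * η j b| ≤ h * Real.sqrt (Torus.gradForm (Torus.isoVisc 1) ξ) * Real.sqrt (Torus.gradForm (Torus.isoVisc 1) η)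

/-- Two tensors are TRANSVERSELY EQUIVALENT when their bilinear transverse symbols agree: `Σ 𝔹 i a j b p_i k_a q_j k_b = Σ 𝔹' i a j b p_i k_a q_j k_b`
for all `k` and all `p, q ⊥ k` (they differ by null Lagrangians + trace couplings; `Torus.OddSmall`, `Torus.NearIso`, the FLAT weak class and — for
HOLONOMIC `G` — the distorted weak class are all blind to the difference). -/
def TransverseEq (𝔹 𝔹' : Torus.Visc4 (Fin 3)) : Prop :=
  ∀ k p q : Fin 3 → ℝ, (∑ l, p l * k l = 0) → (∑ l, q l * k l = 0) → Torus.bsymb 𝔹 k p q = Torus.bsymb 𝔹' k p q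

/-- **TOOL T♮ (to be proved, Literature `Analysis/FluidPDE/PassiveVectorTensorTransverseCanonical`): transverse canonicalisation.**  There is an absolute
constant `C♮` such that every tensor whose transverse bilinear symbol is bounded (symmetric part in `[−h, h]·|k|²|p||q|` — implied by `NearIso 𝔹 lo hi` with
`h = max |lo| |hi|` — and antisymmetric part `≤ β|k|²|p||q|`, `OddSmall 𝔹 β`) is transversely equivalent to a tensor with `FullBound … (C♮·(h + β))`
(finite-dimensional: the transverse symbol is a norm on the orthogonal complement of its kernel in `Visc4 (Fin 3) ≅ ℝ⁸¹`).  Stated here as a `Prop`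
so the certifier can probe the exact shape; it is a DEVICE for the η-route inside the proofs of `NearMultGF` / `BlockBoundGF`, used together with the
class invariance «holonomic distorted weak class of `𝔹` = that of `𝔹'` when `TransverseEq 𝔹 𝔹'`» (Literature lemma T♮2). -/
def TransverseCanonical : Prop :=
  ∃ Cn : ℝ, 0 ≤ Cn ∧ ∀ (𝔹 : Torus.Visc4 (Fin 3)) (lo hi β : ℝ), 0 ≤ β → Torus.NearIso 𝔹 lo hi → Torus.OddSmall 𝔹 β →
    ∃ 𝔹' : Torus.Visc4 (Fin 3), TransverseEq 𝔹 𝔹' ∧ Torus.NearIso 𝔹' lo hi ∧ Torus.OddSmall 𝔹' β ∧ FullBound 𝔹' (Cn * (max |lo| |hi| + β))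

/-! ## §4 The (ℓ3-A) assembly over the class of record (p712075 VERBATIM with the F-texts) -/

set_option maxHeartbeats 1600000 in
/-- **(ℓ3-A) ASSEMBLY over the class of record**: `NearMultGF` (`0 ≤ κ < 1`) and the four `BlockBoundGF` give `SlowVectorClauseModECW0F` with
`Cm = (C₁ + C₂ + C₃ + C₄)/(1 − κ)`.  Proof = `modECW0_of_blockBoundsG_at` verbatim (the modulation datum is only passed through). -/
theorem modECW0F_of_blockBoundsGF_at {k : ℕ} (W : LatticeShear.LatticeWord k) (M : ℝ) (hM : 0 < M) {c : ℝ}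
    (Φ : ℝ → Torus.Visc4 (Fin 3) → Torus.Visc4 (Fin 3)) {lo hi Λ β σ' C₁ C₂ C₃ C₄ ν₀ K θ₁ ϱ₁ κ : ℝ}
    (hκ0 : 0 ≤ κ) (hκ : κ < 1) (hC₁ : 0 ≤ C₁) (hC₂ : 0 ≤ C₂) (hC₃ : 0 ≤ C₃) (hC₄ : 0 ≤ C₄)
    (hNM : NearMultGF c Φ lo hi Λ β ν₀ K θ₁ ϱ₁ κ)
    (B₁ : BlockBoundGF W M hM c Φ lo hi Λ β σ' C₁ ν₀ K θ₁ ϱ₁ IsSlow IsSlow) (B₂ : BlockBoundGF W M hM c Φ lo hi Λ β σ' C₂ ν₀ K θ₁ ϱ₁ IsSlow IsFast)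
    (B₃ : BlockBoundGF W M hM c Φ lo hi Λ β σ' C₃ ν₀ K θ₁ ϱ₁ IsFast IsSlow) (B₄ : BlockBoundGF W M hM c Φ lo hi Λ β σ' C₄ ν₀ K θ₁ ϱ₁ IsFast IsFast) :
    SlowVectorClauseModECW0F W M hM c Φ lo hi Λ β σ' ((C₁ + C₂ + C₃ + C₄) / (1 - κ)) ν₀ K θ₁ ϱ₁ := by
  intro ν hν n hn 𝔸 hodd hwin hΦo hΦw θ hθ nC hnC0 hnC Tw hTw G hG U T hU hT t ht0 htT x ζ
  -- the split at the frequency ball `freqBall (n/4)`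
  set A : Set (Fin 3 → ℤ) := ↑(Torus.freqBall (d := Fin 3) (n / 4)) with hA
  have hAsym : ∀ k', k' ∈ A ↔ -k' ∈ A := fun k' => by
    rw [hA, Finset.mem_coe, Finset.mem_coe, Torus.neg_mem_freqBall]
  obtain ⟨P, hP⟩ := exists_labelProj A hAsym
  have hPoff : ∀ (y : V2) (k' : Fin 3 → ℤ), k' ∉ Torus.freqBall (d := Fin 3) (n / 4) → fc (P y) k' = 0 := by
    intro y k' hk'
    have h := hP y k'
    rw [if_neg (by rwa [hA, Finset.mem_coe] : k' ∉ A)] at h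
    exact h
  have hPon : ∀ (y : V2) (k' : Fin 3 → ℤ), k' ∈ Torus.freqBall (d := Fin 3) (n / 4) → fc (P y) k' = fc y k' := by
    intro y k' hk'
    have h := hP y k'
    rw [if_pos (by rwa [hA, Finset.mem_coe] : k' ∈ A)] at h
    exact h
  set xs : V2 := P x with hxs
  set xf : V2 := x - P x with hxf
  set ζs : V2 := P ζ with hζs
  set ζf : V2 := ζ - P ζ with hζf
  have hx : x = xs + xf := by rw [hxs, hxf]; abel
  have hζ : ζ = ζs + ζf := by rw [hζs, hζf]; abel
  have slow_of : ∀ y : V2, IsSlow n (P y) := fun y k' hk' => hPoff y k' hk'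
  have fast_of : ∀ y : V2, IsFast n (y - P y) := fun y k' hk' => by
    rw [fc_sub, hPon y k' hk', sub_self]
  have hxs_s : IsSlow n xs := slow_of x
  have hxf_f : IsFast n xf := fast_of x
  have hζs_s : IsSlow n ζs := slow_of ζ
  have hζf_f : IsFast n ζf := fast_of ζ
  -- slow and fast pieces are Fourier-disjoint, hence orthogonal
  have disj : ∀ {y y' : V2}, IsSlow n y → IsFast n y' → ∀ k', fc y k' = 0 ∨ fc y' k' = 0 := by
    intro y y' hy hy' k'
    by_cases hk' : k' ∈ Torus.freqBall (d := Fin 3) (n / 4)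
    · exact Or.inr (hy' k' hk')
    · exact Or.inl (hy k' hk')
  have hox : ⟪xs, xf⟫_ℝ = 0 := inner_eq_zero_of_fc_disjoint (disj hxs_s hxf_f)
  have hoζ : ⟪ζs, ζf⟫_ℝ = 0 := inner_eq_zero_of_fc_disjoint (disj hζs_s hζf_f)
  -- the coarse member: contraction, nonnegative losses, near-multiplier cross bounds
  have hTc : ∀ y, ‖T 0 t y‖ ≤ ‖y‖ := hT.norm_le 0 t
  have hq0 : ∀ y, 0 ≤ lossFwd (T 0 t) y := fun y => loss_nonneg hTc y
  have hqs0 : ∀ y, 0 ≤ lossAdj (T 0 t) y := fun y => lossAdj_nonneg hTc y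
  obtain ⟨hNMf, hNMa⟩ := hNM ν hν n hn 𝔸 hodd hwin hΦo hΦw θ hθ nC hnC0 hnC Tw hTw G hG T hT t ht0 htT
  have hsplit : lossFwd (T 0 t) xs + lossFwd (T 0 t) xf ≤ lossFwd (T 0 t) x / (1 - κ) := by
    unfold lossFwd; rw [hx]
    exact loss_split_le_of_nearMult (T 0 t) hκ0 hκ hox (hq0 xs) (hq0 xf) (hNMf xs xf hxs_s hxf_f)
  have hsplitA : lossAdj (T 0 t) ζs + lossAdj (T 0 t) ζf ≤ lossAdj (T 0 t) ζ / (1 - κ) := by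
    unfold lossAdj; rw [hζ]
    have hTa : ∀ y, ‖ContinuousLinearMap.adjoint (T 0 t) y‖ ≤ ‖y‖ := norm_adjoint_le hTc
    exact loss_split_le_of_nearMult (ContinuousLinearMap.adjoint (T 0 t)) hκ0 hκ hoζ (loss_nonneg hTa ζs) (loss_nonneg hTa ζf)
      (hNMa ζs ζf hζs_s hζf_f)
  -- the four block bounds at the pieces
  have b₁₁ := B₁ ν hν n hn 𝔸 hodd hwin hΦo hΦw θ hθ nC hnC0 hnC Tw hTw G hG U T hU hT t ht0 htT xs ζs hxs_s hζs_s
  have b₁₂ := B₂ ν hν n hn 𝔸 hodd hwin hΦo hΦw θ hθ nC hnC0 hnC Tw hTw G hG U T hU hT t ht0 htT xs ζf hxs_s hζf_f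
  have b₂₁ := B₃ ν hν n hn 𝔸 hodd hwin hΦo hΦw θ hθ nC hnC0 hnC Tw hTw G hG U T hU hT t ht0 htT xf ζs hxf_f hζs_s
  have b₂₂ := B₄ ν hν n hn 𝔸 hodd hwin hΦo hΦw θ hθ nC hnC0 hnC Tw hTw G hG U T hU hT t ht0 htT xf ζf hxf_f hζf_f
  -- common currency
  set a : ℝ := ν ^ σ' + ((⌈K / ν⌉₊ : ℝ) / n) ^ σ' + θ ^ σ' + (nC / n) ^ σ' with ha_def
  set m : ℝ := (min 1 ((M * W.period / ν) / t)) ^ σ' with hm_def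
  have ha0 : 0 ≤ a := by
    have h1 : 0 ≤ ν ^ σ' := Real.rpow_nonneg hν.1.le σ'
    have h2 : 0 ≤ ((⌈K / ν⌉₊ : ℝ) / n) ^ σ' := Real.rpow_nonneg (by positivity) σ'
    have h3 : 0 ≤ θ ^ σ' := Real.rpow_nonneg hθ.1 σ'
    have h4 : 0 ≤ (nC / n) ^ σ' := Real.rpow_nonneg (div_nonneg hnC0 (Nat.cast_nonneg n)) σ'
    rw [ha_def]; linarith
  have hP0 : 0 ≤ (M * W.period / ν) / t :=
    div_nonneg (div_nonneg (mul_nonneg hM.le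
      (Summit.AnomalousDissipation.AnomalousDissipation.Theorems.SolenoidalFractalHomogenisation.PermissibleCarrier.period_pos W).le) hν.1.le) ht0.le
  have hm0 : 0 ≤ m := by rw [hm_def]; exact Real.rpow_nonneg (le_min zero_le_one hP0) σ'
  have hη0 : ∀ {Cb : ℝ}, 0 ≤ Cb → 0 ≤ Cb * (Cb * a + m) := fun hCb => mul_nonneg hCb (by positivity)
  -- bilinear expansion and the 2×2 bookkeeping with `A² = q(x)/(1−κ)`, `B² = q*(ζ)/(1−κ)`
  have hκ1 : 0 < 1 - κ := by linarith
  have hlin : U 0 t x - T 0 t x = (U 0 t xs - T 0 t xs) + (U 0 t xf - T 0 t xf) := by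
    rw [hx, map_add, map_add]; abel
  have key := lossBound_add_blocks (v₁ := U 0 t xs - T 0 t xs) (v₂ := U 0 t xf - T 0 t xf) (ζ₁ := ζs) (ζ₂ := ζf)
    (A := Real.sqrt (lossFwd (T 0 t) x / (1 - κ))) (B := Real.sqrt (lossAdj (T 0 t) ζ / (1 - κ)))
    b₁₁ b₁₂ b₂₁ b₂₂ (hη0 hC₁) (hη0 hC₂) (hη0 hC₃) (hη0 hC₄)
    (Real.sqrt_nonneg _) (Real.sqrt_nonneg _) (Real.sqrt_nonneg _) (Real.sqrt_nonneg _)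
    (by rw [Real.sq_sqrt (hq0 xs), Real.sq_sqrt (hq0 xf), Real.sq_sqrt (div_nonneg (hq0 x) hκ1.le)]; exact hsplit)
    (by rw [Real.sq_sqrt (hqs0 ζs), Real.sq_sqrt (hqs0 ζf), Real.sq_sqrt (div_nonneg (hqs0 ζ) hκ1.le)]; exact hsplitA)
  rw [hlin, hζ]
  refine key.trans ?_
  rw [← hζ]
  have hsum := eta_sum_le (m := m) hC₁ hC₂ hC₃ hC₄ ha0
  -- `√(q/(1−κ))·√(q*/(1−κ)) = √q·√q*/(1−κ)` and `(ΣC)((ΣC)a + m)/(1−κ) ≤ Cm(Cm a + m)`, `Cm = ΣC/(1−κ)`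
  set S : ℝ := C₁ + C₂ + C₃ + C₄ with hS
  have hS0 : 0 ≤ S := by rw [hS]; linarith
  have hsq : Real.sqrt (lossFwd (T 0 t) x / (1 - κ)) * Real.sqrt (lossAdj (T 0 t) ζ / (1 - κ))
      = (Real.sqrt (lossFwd (T 0 t) x) * Real.sqrt (lossAdj (T 0 t) ζ)) / (1 - κ) := by
    rw [Real.sqrt_div' _ hκ1.le, Real.sqrt_div' _ hκ1.le, div_mul_div_comm, Real.mul_self_sqrt hκ1.le]
  have hXY : 0 ≤ Real.sqrt (lossFwd (T 0 t) x) * Real.sqrt (lossAdj (T 0 t) ζ) := by positivity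
  have hinv1 : 1 ≤ 1 / (1 - κ) := by rw [le_div_iff₀ hκ1]; linarith
  have hCm : S * (S * a + m) / (1 - κ) ≤ S / (1 - κ) * (S / (1 - κ) * a + m) := by
    rw [div_eq_mul_one_div S, show S * (S * a + m) / (1 - κ) = S * (1 / (1 - κ)) * (S * a + m) by ring]
    refine mul_le_mul_of_nonneg_left ?_ (by positivity)
    have : S * a ≤ S * (1 / (1 - κ)) * a := by
      have := mul_le_mul_of_nonneg_left hinv1 (mul_nonneg hS0 ha0)
      nlinarith [this]
    linarith
  calc (C₁ * (C₁ * a + m) + C₂ * (C₂ * a + m) + C₃ * (C₃ * a + m) + C₄ * (C₄ * a + m))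
        * Real.sqrt (lossFwd (T 0 t) x / (1 - κ)) * Real.sqrt (lossAdj (T 0 t) ζ / (1 - κ))
      = (C₁ * (C₁ * a + m) + C₂ * (C₂ * a + m) + C₃ * (C₃ * a + m) + C₄ * (C₄ * a + m))
        * (Real.sqrt (lossFwd (T 0 t) x / (1 - κ)) * Real.sqrt (lossAdj (T 0 t) ζ / (1 - κ))) := by ring
    _ ≤ (S * (S * a + m)) * (Real.sqrt (lossFwd (T 0 t) x / (1 - κ)) * Real.sqrt (lossAdj (T 0 t) ζ / (1 - κ))) :=
          mul_le_mul_of_nonneg_right hsum (by positivity)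
    _ = (S * (S * a + m) / (1 - κ)) * (Real.sqrt (lossFwd (T 0 t) x) * Real.sqrt (lossAdj (T 0 t) ζ)) := by rw [hsq]; ring
    _ ≤ (S / (1 - κ) * (S / (1 - κ) * a + m)) * (Real.sqrt (lossFwd (T 0 t) x) * Real.sqrt (lossAdj (T 0 t) ζ)) :=
          mul_le_mul_of_nonneg_right hCm hXY
    _ = S / (1 - κ) * (S / (1 - κ) * a + m) * Real.sqrt (lossFwd (T 0 t) x) * Real.sqrt (lossAdj (T 0 t) ζ) := by ring

end Summit.AnomalousDissipation.AnomalousDissipation.Theorems.SolenoidalFractalHomogenisation.LagrangianStep.VmodDist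

end
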